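import Literature.NumberTheory.EllipticCurves.WeierstrassPlaces
import Literature.NumberTheory.DiophantineGeometry.WeierstrassFunctionFieldPlaces
import Literature.NumberTheory.DiophantineGeometry.FunctionFieldZeta
import HarnessLib

/-!
# The rational places of the function field of an elliptic curve are its rational points

Topic `NumberTheory/EllipticCurves`. For an elliptic curve `V` over an ARBITRARY field `k`
(`V : WeierstrassCurve.Affine k`, `[V.IsElliptic]`) with function field `k(V)`, this file proves
that the places of `k(V)/k` of degree one are in canonical bijection with the `k`-rational points
`V(k)` (Mathlib's `V.Point`, i.e. the affine points over `k` together with `O`):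

* `placeOfPoint V : V.Point → PlaceOver k k(V)` — `O ↦ P_∞` (the tree's
  `WeierstrassPlaceAtInfinity.infPlace`) and `(a, b) ↦` the place of the maximal ideal
  `(x - a, y - b)` (the tree's `WeierstrassFunctionField.pointPrime` and
  `AlgFunctionField.PlaceOver.ofPrime`); `placeOfPoint_injective`;
* `algebraMap_residueField_placeOfPoint_surjective`, **`degree_placeOfPoint : deg = 1`** (the
  residue field is `k`: every `u` integral at the point has a value `u(P) ∈ k`, the tree's
  `WeierstrassFunctionField.exists_placeValuation_sub_lt_one`);
* **`exists_placeOfPoint_eq`**: conversely every rational place is the place of a point — a finite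
  rational place `v = P_𝔭` has `x ≡ a`, `y ≡ b (mod m_v)` with `a, b ∈ k` (the structure map
  `k → k_v` is onto), `(a, b)` lies on `V` (reduce the equation) and then `𝔭 = (x - a, y - b)`
  (`r ∈ 𝔭 ↔ r(a, b) = 0`);
* **`pointEquivRatPlaces V : V.Point ≃ {v // v.IsRational}`** and the counts
  `natCard_setOf_isRational`, **`numPlacesOfDegree_one : B₁ = #V(k)`**,
  **`pointCount_one : N₁ = #V(k)`** (Stichtenoth (5.39)–(5.40) at `r = 1`) — the bridge between
  the function-field point counts of `FunctionFieldZeta` (Hasse–Weil, `hasseWeil_holds`) and the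
  point counts of Weierstrass curves (`HasseManin`).

This is Silverman *AEC* II.2 (points of a smooth curve over `k` ↔ degree-one places of its function
field, Prop. II.1.1 with Remark II.2.5 for non-closed `k`) for Weierstrass cubics, whose only place
"at infinity" is `O` (Prop. III.3.1, the tree's `WeierstrassPlaces.eq_infPlace_or_exists_eq_ofPrime`).
Everything is proved; no named facts. Duplicate search: the tree has the alg-closed point/place
dictionary (`WeierstrassPlaces.exists_eq_pointIdeal`, `IsogenyDegreeKernelProofs`), the
classification of all places by `Option (MaxSpec k[V])` (`WeierstrassFunctionFieldPlaces.placeEquiv`)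
and `degree_infPlace`; the degree-one/rational-point identification over a general `k` and the
counts `B₁ = N₁ = #V(k)` are new.

## References

* J. H. Silverman, *The Arithmetic of Elliptic Curves*, 2nd ed., GTM 106, Prop. II.1.1, II.2
  (Remark II.2.5), Prop. III.3.1. [SilvermanAEC2009]
* H. Stichtenoth, *Algebraic Function Fields and Codes*, 2nd ed., GTM 254, Def. 1.1.14, (5.39)–(5.40),
  §6.1. [Stichtenoth2009]
-/

noncomputable section

open scoped Classical Polynomial.Bivariate
open Polynomial IsDedekindDomain

namespace Literature.NumberTheory.EllipticCurves.WeierstrassRationalPlaces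

open Literature.NumberTheory.DiophantineGeometry
open AlgFunctionField WeierstrassPlaceAtInfinity WeierstrassFunctionField

universe u

variable {k : Type u} [Field k] (V : WeierstrassCurve.Affine k) [V.IsElliptic]

/-! ### The place of a rational point -/

/-- **The place of a rational point**: `O ↦ P_∞`, `(a, b) ↦ P_{(x - a, y - b)}`.
[cite: SilvermanAEC2009, Prop. II.1.1 and II.2] -/
def placeOfPoint : V.Point → PlaceOver k V.FunctionField
  | .zero => infPlace V
  | .some _ _ h => PlaceOver.ofPrime k V.FunctionField (pointPrime h.left)

variable {V}

/-- The place of `O` is `P_∞`. [folklore] -/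
@[simp]
theorem placeOfPoint_zero : placeOfPoint V 0 = infPlace V := rfl

/-- The place of an affine point is the place of its maximal ideal. [folklore] -/
theorem placeOfPoint_some {a b : k} (h : V.Nonsingular a b) :
    placeOfPoint V (.some a b h) = PlaceOver.ofPrime k V.FunctionField (pointPrime h.left) := rfl

/-- The place of an affine point is not `P_∞`. [folklore] -/
theorem placeOfPoint_some_ne_infPlace {a b : k} (h : V.Nonsingular a b) :
    placeOfPoint V (.some a b h) ≠ infPlace V :=
  (WeierstrassPlaces.infPlace_ne_ofPrime V _).symm

/-- **`placeOfPoint` is injective.** [folklore] -/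
theorem placeOfPoint_injective : Function.Injective (placeOfPoint V) := by
  rintro (_ | ⟨a, b, h⟩) (_ | ⟨a', b', h'⟩) e
  · rfl
  · exact absurd e.symm (placeOfPoint_some_ne_infPlace h')
  · exact absurd e (placeOfPoint_some_ne_infPlace h)
  · rw [placeOfPoint_some, placeOfPoint_some] at e
    have e' := congrArg HeightOneSpectrum.asIdeal (PlaceOver.ofPrime_injective e)
    rw [pointPrime_asIdeal, pointPrime_asIdeal] at e'
    obtain ⟨rfl, rfl⟩ := pointIdeal_injective h.left e'
    rfl

/-- Membership in the valuation ring of the place of an affine point: `v_P(z) ≤ 1`. [folklore] -/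
theorem mem_placeOfPoint_some_iff {a b : k} (h : V.Nonsingular a b) (z : V.FunctionField) :
    z ∈ (placeOfPoint V (.some a b h)).toValuationSubring ↔ placeValuation V (.some a b h) z ≤ 1 :=
  PlaceOver.mem_ofPrime_iff _ _

/-- The valuation of the place of a point is equivalent to `placeValuation`. [folklore] -/
theorem isEquiv_placeValuation_valuation (P : V.Point) :
    (placeValuation V P).IsEquiv (placeOfPoint V P).valuation := by
  rcases P with _ | ⟨a, b, h⟩
  · exact (infValuationF V).isEquiv_valuation_valuationSubring
  · exact ((pointPrime h.left).valuation V.FunctionField).isEquiv_valuation_valuationSubring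

/-- **The residue field of the place of a rational point is `k`**: the structure map is onto
(every `z` integral at `P` is congruent to its value `z(P) ∈ k`).
[cite: SilvermanAEC2009, Prop. II.1.1 and II.2] -/
theorem algebraMap_residueField_placeOfPoint_surjective (P : V.Point) :
    Function.Surjective (algebraMap k (placeOfPoint V P).residueField) := by
  rcases P with _ | ⟨a, b, h⟩
  · exact algebraMap_residueField_surjective V
  · intro ξ
    obtain ⟨z, rfl⟩ := IsLocalRing.residue_surjective ξ
    have hz : placeValuation V (.some a b h) z ≤ 1 := (mem_placeOfPoint_some_iff h _).1 z.2
    obtain ⟨c, hc⟩ := exists_placeValuation_sub_lt_one _ hz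
    refine ⟨c, ?_⟩
    rw [PlaceOver.algebraMap_residueField_apply, eq_comm, ← sub_eq_zero, ← map_sub,
      IsLocalRing.residue_eq_zero_iff, ValuationSubring.valuation_lt_one_iff]
    exact ((isEquiv_placeValuation_valuation (.some a b h)).lt_one_iff_lt_one).1 hc

/-- **The place of a rational point has degree one.** [cite: SilvermanAEC2009, Prop. II.1.1 and II.2] -/
theorem degree_placeOfPoint (P : V.Point) : (placeOfPoint V P).degree = 1 := by
  have hinj : Function.Injective (algebraMap k (placeOfPoint V P).residueField) :=
    (algebraMap k (placeOfPoint V P).residueField).injective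
  have e : k ≃ₗ[k] (placeOfPoint V P).residueField :=
    LinearEquiv.ofBijective (Algebra.linearMap k (placeOfPoint V P).residueField)
      ⟨hinj, algebraMap_residueField_placeOfPoint_surjective P⟩
  rw [PlaceOver.degree, ← e.finrank_eq, Module.finrank_self]

/-- The place of a rational point is rational. [cite: SilvermanAEC2009, Prop. II.1.1 and II.2] -/
theorem isRational_placeOfPoint (P : V.Point) : (placeOfPoint V P).IsRational :=
  degree_placeOfPoint P

/-! ### Every rational place is the place of a rational point -/

omit [WeierstrassCurve.IsElliptic V] in
/-- At a rational place the structure map `k → k_v` is onto. [folklore] -/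
theorem algebraMap_residueField_surjective_of_isRational {v : PlaceOver k V.FunctionField}
    (hv : v.IsRational) : Function.Surjective (algebraMap k v.residueField) := by
  have h := WeierstrassGenus.surjective_of_degree_eq_one V hv (Algebra.linearMap k v.residueField)
    (z := 1) (by simp)
  exact h

/-- The reduction map `k[V] → k_v` at a finite place `v = P_𝔭` (`k[V] ⊆ 𝒪_v`). [folklore] -/
def reduction (𝔭 : HeightOneSpectrum V.CoordinateRing) :
    V.CoordinateRing →+* (PlaceOver.ofPrime k V.FunctionField 𝔭).residueField :=
  (IsLocalRing.residue _).comp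
    ((algebraMap V.CoordinateRing V.FunctionField).codRestrict _
      (PlaceOver.algebraMap_mem_ofPrime (K := k) (F := V.FunctionField) 𝔭))

/-- `reduction 𝔭 r = 0 ↔ r ∈ 𝔭`. [folklore] -/
theorem reduction_eq_zero_iff (𝔭 : HeightOneSpectrum V.CoordinateRing) (r : V.CoordinateRing) :
    reduction (k := k) 𝔭 r = 0 ↔ r ∈ 𝔭.asIdeal := by
  rw [reduction, RingHom.comp_apply, IsLocalRing.residue_eq_zero_iff,
    ValuationSubring.valuation_lt_one_iff]
  change (𝔭.valuation V.FunctionField).valuationSubring.valuation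
    (algebraMap V.CoordinateRing V.FunctionField r) < 1 ↔ _
  rw [← ((𝔭.valuation V.FunctionField).isEquiv_valuation_valuationSubring).lt_one_iff_lt_one,
    HeightOneSpectrum.valuation_lt_one_iff_mem]

/-- `reduction` on constants. [folklore] -/
theorem reduction_algebraMap (𝔭 : HeightOneSpectrum V.CoordinateRing) (c : k) :
    reduction (k := k) 𝔭 (algebraMap k V.CoordinateRing c) =
      algebraMap k (PlaceOver.ofPrime k V.FunctionField 𝔭).residueField c := by
  rw [PlaceOver.algebraMap_residueField_apply, reduction, RingHom.comp_apply]
  congr 1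

/-- **Every rational place of `k(V)/k` is the place of a rational point.** A rational place is `P_∞`
or a finite place `P_𝔭`; in the latter case `x ≡ a`, `y ≡ b (mod m_v)` with `a, b ∈ k` (the structure
map `k → k_v` is onto), reducing the Weierstrass equation gives `(a, b) ∈ V(k)`, and
`𝔭 = (x - a, y - b)` as `r ∈ 𝔭 ↔ r(a, b) = 0`. [cite: SilvermanAEC2009, Prop. II.1.1 and II.2] -/
theorem exists_placeOfPoint_eq {v : PlaceOver k V.FunctionField} (hv : v.IsRational) :
    ∃ P : V.Point, placeOfPoint V P = v := by
  rcases WeierstrassPlaces.eq_infPlace_or_exists_eq_ofPrime V v with rfl | ⟨𝔭, rfl⟩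
  · exact ⟨0, rfl⟩
  · have hsurj := algebraMap_residueField_surjective_of_isRational hv
    obtain ⟨a, ha⟩ := hsurj (reduction (k := k) 𝔭 (WeierstrassCurve.Affine.CoordinateRing.mk V (C X)))
    obtain ⟨b, hb⟩ := hsurj (reduction (k := k) 𝔭 (WeierstrassCurve.Affine.CoordinateRing.mk V Y))
    -- reduction of `p(x, y)` is `p(a, b)`
    have hhom : (reduction (k := k) 𝔭).comp (WeierstrassCurve.Affine.CoordinateRing.mk V) =
        (algebraMap k _).comp (evalEvalRingHom a b) := by
      refine Polynomial.ringHom_ext' (Polynomial.ringHom_ext' (RingHom.ext fun c => ?_) ?_) ?_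
      · simp only [RingHom.comp_apply, coe_evalRingHom, eval_C]
        exact reduction_algebraMap 𝔭 c
      · simp only [RingHom.comp_apply, coe_evalRingHom, eval_C, eval_X]
        exact ha.symm
      · simp only [RingHom.comp_apply, coe_evalRingHom, eval_C, eval_X]
        exact hb.symm
    have hred : ∀ p : k[X][Y], reduction (k := k) 𝔭 (WeierstrassCurve.Affine.CoordinateRing.mk V p) =
        algebraMap k _ (p.evalEval a b) := fun p => by
      have := congrArg (fun f : k[X][Y] →+* _ => f p) hhom
      simpa using this
    -- `(a, b)` lies on the curve
    have heq : V.Equation a b := by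
      have h0 := hred V.polynomial
      rw [show WeierstrassCurve.Affine.CoordinateRing.mk V V.polynomial = 0 from AdjoinRoot.mk_self,
        map_zero, eq_comm, map_eq_zero_iff _ (algebraMap k _).injective] at h0
      exact h0
    have hns : V.Nonsingular a b := (WeierstrassCurve.Affine.equation_iff_nonsingular).mp heq
    refine ⟨.some a b hns, ?_⟩
    rw [placeOfPoint_some]
    congr 1
    -- `pointPrime = 𝔭`: `r ∈ (x - a, y - b) ↔ r(a, b) = 0 ↔ reduction r = 0 ↔ r ∈ 𝔭`
    apply HeightOneSpectrum.ext
    rw [pointPrime_asIdeal]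
    ext r
    obtain ⟨p, rfl⟩ := AdjoinRoot.mk_surjective r
    change WeierstrassCurve.Affine.CoordinateRing.mk V p ∈ pointIdeal V a b ↔ _
    rw [mk_mem_pointIdeal_iff heq, ← reduction_eq_zero_iff (k := k), hred,
      map_eq_zero_iff _ (algebraMap k _).injective]

variable (V) in
/-- **The rational points of `V` are the rational places of `k(V)/k`.**
[cite: SilvermanAEC2009, Prop. II.1.1 and II.2] -/
def pointEquivRatPlaces : V.Point ≃ {v : PlaceOver k V.FunctionField // v.IsRational} :=
  Equiv.ofBijective (fun P => ⟨placeOfPoint V P, isRational_placeOfPoint P⟩)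
    ⟨fun P Q h => placeOfPoint_injective (congrArg Subtype.val h),
      fun v => by
        obtain ⟨P, hP⟩ := exists_placeOfPoint_eq v.2
        exact ⟨P, Subtype.ext hP⟩⟩

/-- Unfolding of `pointEquivRatPlaces`. [folklore] -/
@[simp]
theorem coe_pointEquivRatPlaces (P : V.Point) : (pointEquivRatPlaces V P : PlaceOver k V.FunctionField) = placeOfPoint V P :=
  rfl

/-- **The number of rational places of `k(V)/k` is `#V(k)`.** [cite: SilvermanAEC2009, Prop. II.1.1 and II.2] -/
theorem natCard_isRational :
    Nat.card {v : PlaceOver k V.FunctionField // v.IsRational} = Nat.card V.Point :=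
  (Nat.card_congr (pointEquivRatPlaces V)).symm

/-- **`B₁ = #V(k)`**: the number of places of degree one of `k(V)/k` (Stichtenoth (5.39)) is the
number of rational points. [cite: Stichtenoth2009, eq. (5.39)] -/
theorem numPlacesOfDegree_one :
    numPlacesOfDegree k V.FunctionField 1 = Nat.card V.Point :=
  natCard_isRational

/-- **`N₁ = #V(k)`**: the point count `N₁ = Σ_{d ∣ 1} d B_d = B₁` of `FunctionFieldZeta`
(Stichtenoth (5.40)) is the number of rational points of the elliptic curve.
[cite: Stichtenoth2009, eq. (5.40)] -/
theorem pointCount_one : pointCount k V.FunctionField 1 = Nat.card V.Point := by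
  rw [pointCount, Nat.divisors_one, Finset.sum_singleton, one_mul, numPlacesOfDegree_one]

end Literature.NumberTheory.EllipticCurves.WeierstrassRationalPlaces
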